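import Summits.QuantumAdvantage.QuantumAdvantage.Theorems.CharDialTokenDialE
import Summits.QuantumAdvantage.QuantumAdvantage.Theorems.CharDialTokenDialC
import HarnessLib

/-!
# CharDial tower — the TOKEN DIAL, part F: the seven-dial split of T by name (every `K`), and its certificates

Cell `decomp-qadv`, lens 6, generation 19 (REV1); supports stmt-QuantumAdvantage-27206 / 27207 / 32604.  Imports part E
(Theses-free) and part C (hence `CharDialTowerE` and `Theses.CharDial`); nothing cell-side is imported by the route file.

* ★★ `closes_split7 K` / `split7_of_closes K` / `walkHardFJLinOdd_iff_residual7_split K` / `walkHardFJLinOdd_iff_residual7 K`: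
  for EVERY reader budget `K`, `T = WalkHardFJLinOdd ⟺ LOW-RESIDUAL⁷(dialB, K) ∧ RESIDUAL-HIGH⁷(dialB, K) ⟺ RESIDUAL⁷(K)` BY NAME;
  ★ `jlinLowResidual5_iff_lowResidual7 K`, `jlinResidualHigh5_iff_residualHigh7 K`: the two filed pieces of the RES⁵ split (items
  27206, 27207) are, by name, EQUIVALENT to their seven-dial residuals — the local token dial is absorbed on both sides.
* ★★★ `residualHigh7_class_inhabited K`: the hypothesis class of RESIDUAL-HIGH⁷(K) is INHABITED for every `K` (`fieldY`, every prime
  `p ≥ 5`, eventually): at EVERY adjacent pair `fieldY` has more than `K` READERS in every presentation (`field_not_tokenLoc`: a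
  column `r` jumps at the pair (`exists_col_jump`), and the `K+1` full-pattern cuts `cutAt r k c₀` (`c₀` = the column-`r` form value of
  the indicator input of `s`) change their answer under the transposition of that input (`fieldY_flip`) — a dead cut cannot).
WHAT THIS IS NOT: a proof of either residual piece; no inhabitant of the LOW-RESIDUAL⁷ class is certified (open: whether the
local-junta strategies of the node memo, which escape the token dial, escape the local token dial for large `K`).  0 sorry.
-/

set_option autoImplicit false

open Finset

namespace Summit.QuantumAdvantage.AdviceFreeQNC0.JLinPeel.TokenDial

open SegMove

variable {n : ℕ}

/-! ### (1) the seven-dial split of T, by name, every `K` -/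

/-- ★★ **the DECIDING THEOREM of the seven-dial split** (item vocabulary, every `K`): LOW-RESIDUAL⁷ ∧ RESIDUAL-HIGH⁷ at schedule
`dialB` close `T`. -/
theorem closes_split7 (K : ℕ) (hL : TowerDefs.LowResidual7Side TowerDefs.dialB K)
    (hH : TowerDefs.ResidualHigh7Side TowerDefs.dialB K) :
    Summit.QuantumAdvantage.QuantumAdvantage.Theses.CharDial.WalkHardFJLinOdd :=
  closes_split6 ((lowResidual6_iff_lowResidual7 TowerDefs.dialB K).2 hL)
    ((residualHigh6_iff_residualHigh7 TowerDefs.dialB K).2 hH)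

/-- ★★ conversely `T` gives both seven-dial pieces, every `K`. -/
theorem split7_of_closes (K : ℕ) (hT : Summit.QuantumAdvantage.QuantumAdvantage.Theses.CharDial.WalkHardFJLinOdd) :
    TowerDefs.LowResidual7Side TowerDefs.dialB K ∧ TowerDefs.ResidualHigh7Side TowerDefs.dialB K :=
  let ⟨hL, hH⟩ := split6_of_closes hT
  ⟨(lowResidual6_iff_lowResidual7 TowerDefs.dialB K).1 hL, (residualHigh6_iff_residualHigh7 TowerDefs.dialB K).1 hH⟩

/-- ★★ `T ⟺ LOW-RESIDUAL⁷(dialB, K) ∧ RESIDUAL-HIGH⁷(dialB, K)`, every `K`. -/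
theorem walkHardFJLinOdd_iff_residual7_split (K : ℕ) :
    Summit.QuantumAdvantage.QuantumAdvantage.Theses.CharDial.WalkHardFJLinOdd ↔
      (TowerDefs.LowResidual7Side TowerDefs.dialB K ∧ TowerDefs.ResidualHigh7Side TowerDefs.dialB K) :=
  ⟨split7_of_closes K, fun h => closes_split7 K h.1 h.2⟩

/-- ★★ `T ⟺ RESIDUAL⁷(K)` (all seven dials absorbed, no variation split), every `K`. -/
theorem walkHardFJLinOdd_iff_residual7 (K : ℕ) :
    Summit.QuantumAdvantage.QuantumAdvantage.Theses.CharDial.WalkHardFJLinOdd ↔ TowerDefs.Residual7Side K :=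
  walkHardFJLinOdd_iff_residual6.trans (residual5_iff_residual6.symm.trans (residual5_iff_residual7 K))

/-- ★ the filed LOW piece (item 27206) ⟺ LOW-RESIDUAL⁷(dialB, K), by name, every `K`. -/
theorem jlinLowResidual5_iff_lowResidual7 (K : ℕ) :
    Summit.QuantumAdvantage.QuantumAdvantage.Theses.CharDial.JLinLowResidual5 ↔
      TowerDefs.LowResidual7Side TowerDefs.dialB K :=
  jlinLowResidual5_iff_lowResidual6.trans (lowResidual6_iff_lowResidual7 TowerDefs.dialB K)

/-- ★ the filed HIGH residual (item 27207) ⟺ RESIDUAL-HIGH⁷(dialB, K), by name, every `K`. -/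
theorem jlinResidualHigh5_iff_residualHigh7 (K : ℕ) :
    Summit.QuantumAdvantage.QuantumAdvantage.Theses.CharDial.JLinResidualHigh5 ↔
      TowerDefs.ResidualHigh7Side TowerDefs.dialB K :=
  jlinResidualHigh5_iff_residualHigh6.trans (residualHigh6_iff_residualHigh7 TowerDefs.dialB K)

/-! ### (2) the RESIDUAL-HIGH⁷ class is inhabited: `fieldY` has more than `K` readers at every adjacency -/

section Escape

variable {p : ℕ} [hp : Fact p.Prime]

/-- **`fieldY` escapes the local token dial with `K` readers** whenever `K + 1` full-pattern cuts per column fit: at an adjacent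
pair some column `r` jumps, and the `K+1` cuts `cutAt r k c₀` all READ the pair (they flip on the transposed indicator input of `s`),
so no reader set of size `≤ K` leaves the rest dead — in ANY presentation `D` of `fieldY`. -/
theorem field_not_tokenLoc (n K Kb : ℕ) (hbig : p * (NullDial.sepM p n + (FieldCol.rk n + 1) * (Kb + 2)) ≤ n + 1)
    (hK : K + 1 ≤ Kb) (α : GaloisField p (FieldCol.rk n)) (h0 : α ≠ 0) (h1 : α ≠ 1)
    (D : JLinPeel.JLinData p n) (hD : D.strat = FieldCol.fieldY p n α) : ¬ TowerDefs.TokenHypLoc K D := by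
  classical
  haveI : NeZero p := ⟨hp.out.ne_zero⟩
  rintro ⟨s, t, hst, G, hGK, hdead, -⟩
  obtain ⟨r, hr⟩ := FieldCol.exists_col_jump p n α h0 h1 s t hst
  have hts : t ≠ s := fun h => by rw [h] at hst; omega
  set u₀ : Fin n → Bool := fun i => decide (i = s) with hu₀
  have hne : u₀ s ≠ u₀ t := by rw [hu₀]; simp [hts]
  set c₀ : Fin p := ⟨(form (FieldCol.col p n α r) u₀).val, ZMod.val_lt _⟩ with hc₀
  have hcu : ((c₀.val : ℕ) : ZMod p) = form (FieldCol.col p n α r) u₀ := ZMod.natCast_zmod_val _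
  set f : Fin (K + 1) → Fin (n + 1) := fun k => FieldCol.cutAt p n Kb hbig r ⟨k.val, lt_of_lt_of_le k.isLt hK⟩ c₀ with hf0
  have hf : Function.Injective f := by
    intro k k' hkk
    have h := FieldCol.cutAt_injective p n Kb hbig r c₀ hkk
    exact Fin.ext (by simpa using congrArg Fin.val h)
  have hmem : ∀ k, f k ∈ G := by
    intro k
    by_contra hk
    obtain ⟨ha, hs, ht⟩ := hdead (f k) hk
    have heq : D.strat (f k) (segCompl u₀ s.val (s.val + 2)) = D.strat (f k) u₀ := by
      rw [strat_eq, strat_eq]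
      exact cut_swap_insensitive (D.J (f k)) (D.a (f k)) (D.h (f k)) (D.hJ (f k)) u₀ s t hst hne ha hs ht
    rw [hD] at heq
    exact FieldCol.fieldY_flip p n Kb hbig α r _ c₀ u₀ s t hst hne hr hcu heq
  have h1c : (univ.image f).card = K + 1 := by rw [card_image_of_injective _ hf, card_univ, Fintype.card_fin]
  have h2c : univ.image f ⊆ G := fun g hg => by
    obtain ⟨k, -, rfl⟩ := mem_image.1 hg
    exact hmem k
  have h3c := card_le_card h2c
  omega

/-- `K + 1 ≤ 2·(4·(log₂ n + 1)) + 1` once `n ≥ 2^K`. -/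
theorem readers_fit (K : ℕ) (hn : 2 ^ K ≤ n) : K + 1 ≤ 2 * (4 * (Nat.log 2 n + 1)) + 1 := by
  have hK : K ≤ Nat.log 2 n := Nat.le_log_of_pow_le (by norm_num) hn
  omega

/-- ★★★ **`fieldY` in class(RESIDUAL-HIGH⁷(K)), eventually** (every prime `p ≥ 5`, every `K`): JLin-presentable (junta-free), HIGH at
`dialB`, and in EVERY `log₂ n`-junta presentation outside the rank, sparse, block, null, mask AND local-token(`K`) dials.  (The proof
re-assembles part C's `fieldY_class6_eventually` from the public `FieldCol` ingredients, because the genericity `α ∉ {0,1}` it needs is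
not visible in that statement.) -/
theorem fieldY_class7_eventually (hp5 : 5 ≤ p) (K : ℕ) : ∃ n₀ : ℕ, ∀ n ≥ n₀, ∃ α : GaloisField p (FieldCol.rk n),
    TowerDefs.JLinHyp p n (FieldCol.fieldY p n α) ∧ ¬ TowerDefs.LowVar TowerDefs.dialB n (FieldCol.fieldY p n α) ∧
    ∀ D : JLinPeel.JLinData p n, D.strat = FieldCol.fieldY p n α → (∀ g, (D.J g).card ≤ Nat.log 2 n) →
      ¬ TowerDefs.SpanHyp D ∧ ¬ TowerDefs.SparseHyp D ∧ ¬ TowerDefs.BlockHyp D ∧ ¬ TowerDefs.NullHyp D ∧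
        ¬ TowerDefs.MaskHyp D ∧ ¬ TowerDefs.TokenHypLoc K D := by
  have hp3 : p % 3 = 1 ∨ p % 3 = 2 := Tower.mod3_of_prime_ge5 hp.out hp5
  obtain ⟨n₁, hn₁⟩ := FieldCol.eventually_fits p
  obtain ⟨n₂, hn₂⟩ := FieldCol.eventually_big p
  obtain ⟨n₃, hn₃⟩ := FieldCol.eventually_misc p
  obtain ⟨n₄, hn₄⟩ := FieldCol.field_not_span_eventually p
  refine ⟨max (max (max n₁ n₂) (max n₃ n₄)) (2 ^ K), fun n hn => ?_⟩
  have hn' : max (max n₁ n₂) (max n₃ n₄) ≤ n := le_trans (le_max_left _ _) hn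
  have hK := readers_fit (n := n) K (le_trans (le_max_right _ _) hn)
  have hfit := hn₁ n (le_trans (le_trans (le_max_left _ _) (le_max_left _ _)) hn')
  have hbig := hn₂ n (le_trans (le_trans (le_max_right _ _) (le_max_left _ _)) hn')
  obtain ⟨hpL, hpn, hn9⟩ := hn₃ n (le_trans (le_trans (le_max_left _ _) (le_max_right _ _)) hn')
  have hspan := hn₄ n (le_trans (le_trans (le_max_right _ _) (le_max_right _ _)) hn')
  obtain ⟨α, hα⟩ := FieldCol.exists_generic p n (by omega)
  have h0 : α ≠ 0 := FieldCol.generic_ne_zero p n (by omega) α hα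
  have h1 : α ≠ 1 := FieldCol.generic_ne_one p n hpL hpn α hα
  have hL2 : 2 ≤ Nat.log 2 n := le_trans (by omega) hpL
  refine ⟨α, ?_, FieldCol.not_low_fieldY p n _ hbig le_rfl (by omega) α h0 h1, fun D hD hJ => ?_⟩
  · intro g
    exact ⟨∅, by simp, (FieldCol.fieldData p n α).a g, (FieldCol.fieldData p n α).h g, fun _ _ _ _ => rfl, fun u => rfl⟩
  · have hM : ¬ TowerDefs.MaskHyp D := (Tower.maskHyp_iff_inlined D).not.mpr (FieldCol.field_not_mask p n hfit α hα D hD hJ)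
    exact ⟨(Tower.spanHyp_iff_inlined D).not.mpr (hspan α D hD hJ),
      (Tower.sparseHyp_iff_inlined D).not.mpr (FieldCol.field_not_sparse p n hfit hL2 α D hD),
      fun hB => hM (Tower.maskHyp_of_blockHyp hp3 D hB), fun hN => hM (Tower.maskHyp_of_nullHyp D hN), hM,
      field_not_tokenLoc n K _ hbig hK α h0 h1 D hD⟩

/-- ★★★ **class(RESIDUAL-HIGH⁷(K)) IS INHABITED**, every `K` (item vocabulary): for every prime `p ≥ 5` and all large `n` some strategy
satisfies the JLin hypothesis, is HIGH at schedule `dialB`, and escapes the five decided dials AND the local token dial with `K` readers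
in every `log₂ n`-junta ⊕ one-form presentation. -/
theorem residualHigh7_class_inhabited (p : ℕ) [Fact p.Prime] (hp5 : 5 ≤ p) (K : ℕ) :
    ∃ n₁ : ℕ, ∀ n ≥ n₁, ∃ y : Fin (n + 1) → (Fin n → Bool) → Bool,
      TowerDefs.JLinHyp p n y ∧ ¬ TowerDefs.LowVar TowerDefs.dialB n y ∧
      ∀ D : JLinPeel.JLinData p n, D.strat = y → (∀ g, (D.J g).card ≤ Nat.log 2 n) →
        ¬ TowerDefs.SpanHyp D ∧ ¬ TowerDefs.SparseHyp D ∧ ¬ TowerDefs.BlockHyp D ∧ ¬ TowerDefs.NullHyp D ∧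
          ¬ TowerDefs.MaskHyp D ∧ ¬ TowerDefs.TokenHypLoc K D := by
  obtain ⟨n₀, h⟩ := fieldY_class7_eventually (p := p) hp5 K
  exact ⟨n₀, fun n hn => let ⟨α, hy, hV, hesc⟩ := h n hn; ⟨FieldCol.fieldY p n α, hy, hV, hesc⟩⟩

/-- ★ **RESIDUAL-HIGH⁷(K) is tested NON-VACUOUSLY**: a purported `ResidualHigh7Side dialB K` bound applies to an actual member of its class. -/
theorem residualHigh7_nonvacuous (K : ℕ) (hR : TowerDefs.ResidualHigh7Side TowerDefs.dialB K) (p : ℕ) [Fact p.Prime]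
    (hp5 : 5 ≤ p) :
    ∃ θ : ℝ, θ < 1 ∧ ∃ n₀ : ℕ, ∀ n ≥ n₀, ∃ y : Fin (n + 1) → (Fin n → Bool) → Bool,
      TowerDefs.JLinHyp p n y ∧ ¬ TowerDefs.LowVar TowerDefs.dialB n y ∧ ∀ c : ℕ,
        ((Finset.univ.filter fun u : Fin n → Bool => ringWinU c y u = true).card : ℝ) ≤ θ * (2 : ℝ) ^ n := by
  obtain ⟨θ, hθ, n₀, h⟩ := hR p hp5
  obtain ⟨n₁, h₁⟩ := residualHigh7_class_inhabited p hp5 K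
  refine ⟨θ, hθ, max n₀ n₁, fun n hn => ?_⟩
  obtain ⟨y, hy, hV, hesc⟩ := h₁ n (le_trans (le_max_right _ _) hn)
  exact ⟨y, hy, hV, fun c => h n (le_trans (le_max_left _ _) hn) c y hy hV hesc⟩

end Escape

end Summit.QuantumAdvantage.AdviceFreeQNC0.JLinPeel.TokenDial
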